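import Literature.NumberTheory.EllipticCurves.BurungaleSkinner2023.RankOneTwistsPAdicRegulator
import HarnessLib

/-!
# Burungale–Skinner 2023 — the printed values of `r_ℓ` (PROVED checks of `numPrimesAbove`)

A. Burungale, C. Skinner, Proc. AMS Ser. B 10 (2023): `r_ℓ = p^{ord_p((ℓ^{p−1}−1)/p)}` (§2.1.1,
p. 16; tree `BurungaleSkinner2023.numPrimesAbove`). The paper prints five values, all reproduced here
from the definition — a faithfulness check of the transcription:

* Example 1 (p. 18): `p = 5`, `ℓ = 11`: "`r₁₁ = 1`" (also (E4), p. 24);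
* Example 2 (p. 18): `p = 3`, `ℓ = 19`: "`r₁₉ = 3`";
* (E1) (p. 22): `p = 3`, `ℓ = 7`: "`r₇ = 1`";
* (E2) (p. 22): `p = 3`, `ℓ = 2`: "`r₂ = 1`";
* (E5) (p. 24): `p = 7`, `ℓ = 13`: "`r₁₃ = 1`".

Theorems only; no facts. References: [BurungaleSkinner2023] §2.1.1, Examples 1–2 (p. 18), (E1), (E2)
(p. 22), (E4), (E5) (p. 24).
-/

namespace Literature.NumberTheory.EllipticCurves.BurungaleSkinner2023

/-- (E1), p. 22: "Note that `r₇ = 1`" (`p = 3`: `(7² − 1)/3 = 16`, `3 ∤ 16`).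
[cite: BurungaleSkinner2023, Example (E1) (p. 22)] -/
theorem numPrimesAbove_three_seven : numPrimesAbove 3 7 = 1 := by
  rw [numPrimesAbove, show (7 ^ (3 - 1) - 1) / 3 = 16 by norm_num,
    padicValNat.eq_zero_of_not_dvd (by norm_num), pow_zero]

/-- (E2), p. 22: "As `r₂ = 1`" (`p = 3`: `(2² − 1)/3 = 1`).
[cite: BurungaleSkinner2023, Example (E2) (p. 22)] -/
theorem numPrimesAbove_three_two : numPrimesAbove 3 2 = 1 := by
  rw [numPrimesAbove, show (2 ^ (3 - 1) - 1) / 3 = 1 by norm_num, padicValNat_one_right, pow_zero]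

/-- Example 2, p. 18: "Indeed, `r₁₉ = 3`" (`p = 3`: `(19² − 1)/3 = 120 = 3 · 40`, `3 ∤ 40`) — the
`X₀(19)` example where "the `λ`-invariants `λ(E^ψ)` are all at least `3`".
[cite: BurungaleSkinner2023, Example 2 (p. 18)] -/
theorem numPrimesAbove_three_nineteen : numPrimesAbove 3 19 = 3 := by
  haveI : Fact (Nat.Prime 3) := ⟨by norm_num⟩
  rw [numPrimesAbove, show (19 ^ (3 - 1) - 1) / 3 = 3 * 40 by norm_num,
    padicValNat.mul (by norm_num) (by norm_num), padicValNat.self (by norm_num),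
    padicValNat.eq_zero_of_not_dvd (by norm_num)]
  norm_num

/-- Example 1 / (E4), pp. 18, 24: "Indeed, `r₁₁ = 1`" (`p = 5`: `(11⁴ − 1)/5 = 2928`, `5 ∤ 2928`).
[cite: BurungaleSkinner2023, Example 1 (p. 18) and (E4) (p. 24)] -/
theorem numPrimesAbove_five_eleven : numPrimesAbove 5 11 = 1 := by
  rw [numPrimesAbove, show (11 ^ (5 - 1) - 1) / 5 = 2928 by norm_num,
    padicValNat.eq_zero_of_not_dvd (by norm_num), pow_zero]

/-- (E5), p. 24: "Note that `r₁₃ = 1`" (`p = 7`: `(13⁶ − 1)/7 = 689544`, `7 ∤ 689544`).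
[cite: BurungaleSkinner2023, Example (E5) (p. 24)] -/
theorem numPrimesAbove_seven_thirteen : numPrimesAbove 7 13 = 1 := by
  rw [numPrimesAbove, show (13 ^ (7 - 1) - 1) / 7 = 689544 by norm_num,
    padicValNat.eq_zero_of_not_dvd (by norm_num), pow_zero]

end Literature.NumberTheory.EllipticCurves.BurungaleSkinner2023
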